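import Summits.Ventures.HSemireg.WedgeHankelSubstitutionShearCyclic
import Summits.Ventures.HSemireg.WedgeHankelSubstitutionJordanPartitionParabolic

/-!
# Venture HSemireg — THE CENTRALIZER OF THE SHEAR ON TH-7's CLASSES IS THE POLYNOMIAL ALGEBRA IN THE SHEAR when `n!·λ ≠ 0`: every endomorphism commuting with
# `SbC(shear λ)` is `Σ_{k ≤ n} c_k (SbC(shear λ) − 1)^k`, the `c_k` being the coordinates of `φ(E_0)` in the cyclic basis `(SbC(shear λ) − 1)^k E_0`; the powers
# `N^0, …, N^n` are linearly independent, so the centralizer has dimension exactly `n + 1` (characteristic `0` or `p > n`)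

HONEST FRAMING. Part of the Lean index of the computation cell `pub-hsemireg` (seat p10 gen 21, Sunday typer «UNIFORM-IN-n»).
Finite-dimensional EXTERIOR ALGEBRA + linear algebra ONLY: no variety, no cohomology theory, no sheaf, no Ext group, no semiregularity map;
nothing here says that HC / HC_CM / HC_AV holds; no Literature fact is declared or used.  Custodian versions as in `WedgeHankelSiegelIdeal` (1/3) and `WedgeHankelFrameChange`;
the dictionary (a regular unipotent element of `GL(Sym^n)`: its centralizer in `End` is the algebra it generates) is QUOTED, never asserted.

WHAT IS IN THE TREE.  K11 (`WedgeHankelSubstitutionShearCyclic`, this seat): `linearIndependent_pow_shear_spikeBasis_zero`, `span_pow_shear_spikeBasis_zero_eq_top` (`n!·λ ≠ 0`: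
the iterates `N^k E_0`, `k ≤ n`, are a basis of the class space); K5 (`WedgeHankelSubstitutionJordanPartitionParabolic`): `pow_mul_eq_mul_pow_of_mul_eq`; J13
(`WedgeHankelClassSpaceSchur`): commuting with shear AND swap ⇒ scalar.  THIS FILE (namespace `Summit.Ventures.HSemireg.Wedge.HankelFrameChange` continued; imports K11, K5)
computes the centralizer of the shear ALONE:
* §295 `cyclicBasis`-free statements: **`apply_eq_sum_of_commute_shear`** (`n!·λ ≠ 0`, `φ·N = N·φ` ⇒ `φ = Σ_{k ≤ n} c_k • N^k` with `c = ` the coordinates of `φ E_0` in the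
  basis `N^k E_0`), `mem_span_pow_of_commute_shear` (`φ ∈ span{N^0, …, N^n}`), `commute_of_mem_span_pow` (converse), **`linearIndependent_pow_shear_sub_one`** (the endomorphisms
  `N^0, …, N^n` are linearly independent — evaluate at `E_0`), **`finrank_span_pow_shear_sub_one`** (`= n + 1`), and the packaging **`mem_span_pow_iff_commute_shear`**: for `n!·λ ≠ 0`
  an endomorphism of th-7's class space commutes with the shear `SbC(1 λ 0 1)` IFF it is a polynomial (of degree `≤ n`) in it; `commute_shear_iff_commute_sub_one`.
NOT typed here: the centralizer in characteristic `p ≤ n` (strictly bigger than `K[N]`: `dim = Σ_{i,j} min(λ_i, λ_j)` for the Jordan type `(p, …, p, n%p+1)` of K1 — not typed);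
anything Ext-side.  New names only.
-/

open Module

namespace Summit.Ventures.HSemireg.Wedge.HankelFrameChange

open Summit.Ventures.HSemireg.Wedge Summit.Ventures.HSemireg.Wedge.Kunneth Summit.Ventures.HSemireg.Wedge.Hankel
  Summit.Ventures.HSemireg.Wedge.BasisFree Summit.Ventures.HSemireg.Wedge.HankelSiegel Summit.Ventures.HSemireg.Wedge.HankelSiegelIdeal
  Summit.Ventures.HSemireg.Wedge.KunnethKernel Summit.Ventures.HSemireg.Wedge.HankelRankOne Summit.Ventures.HSemireg.Wedge.KernelDuality

variable (K : Type*) [Field K] {n : ℕ}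

/-! ## §295. The centralizer of the shear is `K[N]`, `N = SbC(shear λ) − 1`, when `n!·λ ≠ 0` -/

/-- commuting with the shear `SbC(1 λ 0 1)` is the same as commuting with `N = SbC(1 λ 0 1) − 1`. -/
theorem commute_shear_iff_commute_sub_one (lam : K) (φ : spikeSpan K n →ₗ[K] spikeSpan K n) :
    φ * SbC K 1 lam 0 1 = SbC K 1 lam 0 1 * φ ↔ φ * (SbC K 1 lam 0 1 - 1) = (SbC K 1 lam 0 1 - 1) * φ := by
  constructor
  · intro h
    refine LinearMap.ext fun v => ?_
    have hv := congrArg (fun ψ : spikeSpan K n →ₗ[K] spikeSpan K n => ψ v) h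
    simp only [Module.End.mul_apply] at hv
    simp only [Module.End.mul_apply, LinearMap.sub_apply, Module.End.one_apply, map_sub, hv]
  · intro h
    refine LinearMap.ext fun v => ?_
    have hv := congrArg (fun ψ : spikeSpan K n →ₗ[K] spikeSpan K n => ψ v) h
    simp only [Module.End.mul_apply, LinearMap.sub_apply, Module.End.one_apply, map_sub] at hv
    simp only [Module.End.mul_apply]
    exact sub_left_injective hv

/-- `n!·λ ≠ 0`: the hypothesis `∀ k < n + 1, k! ≠ 0` of K11 from `n! ≠ 0`. -/
theorem factorial_cast_ne_zero_of_lt_of_factorial (hfac : ((n.factorial : ℕ) : K) ≠ 0) {k : ℕ} (hk : k < n + 1) : ((k.factorial : ℕ) : K) ≠ 0 := fun h0 => hfac (by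
  obtain ⟨c, hc⟩ := Nat.factorial_dvd_factorial (show k ≤ n by omega)
  rw [hc, Nat.cast_mul, h0, zero_mul])

/-- **`n!·λ ≠ 0`: AN ENDOMORPHISM COMMUTING WITH THE SHEAR IS A POLYNOMIAL IN IT — `φ = Σ_{k ≤ n} c_k • (SbC(shear λ) − 1)^k`, where `c` are the coordinates of `φ(E_0)` in the
cyclic basis `N^k E_0`** (both sides agree on that basis: `φ(N^k E_0) = N^k φ(E_0) = Σ_j c_j N^{j+k} E_0`). -/
theorem apply_eq_sum_of_commute_shear (hfac : ((n.factorial : ℕ) : K) ≠ 0) {lam : K} (hlam : lam ≠ 0) {φ : spikeSpan K n →ₗ[K] spikeSpan K n}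
    (hφ : φ * (SbC K 1 lam 0 1 - 1) = (SbC K 1 lam 0 1 - 1) * φ) :
    ∃ c : Fin (n + 1) → K, φ = ∑ k : Fin (n + 1), c k • (SbC K 1 lam 0 1 - 1) ^ (k : ℕ) := by
  set N := SbC K 1 lam 0 1 (n := n) - 1 with hN
  have hli := linearIndependent_pow_shear_spikeBasis_zero K hlam le_rfl (m := n + 1) (fun k hk => factorial_cast_ne_zero_of_lt_of_factorial K hfac hk)
  have hsp := span_pow_shear_spikeBasis_zero_eq_top K hfac hlam
  let b : Basis (Fin (n + 1)) K (spikeSpan K n) := Basis.mk hli hsp.ge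
  have hb : ∀ k : Fin (n + 1), b k = (N ^ (k : ℕ)) (spikeBasis K n 0) := fun k => by rw [Basis.mk_apply]
  refine ⟨b.repr (φ (spikeBasis K n 0)), b.ext fun k => ?_⟩
  -- `φ (N^k E_0) = N^k (φ E_0)`
  have hcomm : ∀ k : ℕ, φ * N ^ k = N ^ k * φ := fun k => by
    induction k with
    | zero => rw [pow_zero, mul_one, one_mul]
    | succ k ih => rw [pow_succ, ← mul_assoc, ih, mul_assoc, hφ, ← mul_assoc]
  have h1 : φ (b k) = (N ^ (k : ℕ)) (φ (spikeBasis K n 0)) := by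
    rw [hb, ← Module.End.mul_apply, hcomm, Module.End.mul_apply]
  rw [h1]
  conv_lhs => rw [← b.sum_repr (φ (spikeBasis K n 0))]
  rw [map_sum, LinearMap.sum_apply]
  refine Finset.sum_congr rfl fun j _ => ?_
  rw [map_smul, LinearMap.smul_apply, hb, hb, ← Module.End.mul_apply, ← Module.End.mul_apply, ← pow_add, ← pow_add, add_comm (k : ℕ) (j : ℕ)]

/-- **… i.e. it lies in the span of `N^0, N^1, …, N^n`.** -/
theorem mem_span_pow_of_commute_shear (hfac : ((n.factorial : ℕ) : K) ≠ 0) {lam : K} (hlam : lam ≠ 0) {φ : spikeSpan K n →ₗ[K] spikeSpan K n}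
    (hφ : φ * (SbC K 1 lam 0 1 - 1) = (SbC K 1 lam 0 1 - 1) * φ) :
    φ ∈ Submodule.span K (Set.range fun k : Fin (n + 1) => (SbC K 1 lam 0 1 (n := n) - 1) ^ (k : ℕ)) := by
  obtain ⟨c, rfl⟩ := apply_eq_sum_of_commute_shear K hfac hlam hφ
  exact Submodule.sum_mem _ fun k _ => Submodule.smul_mem _ _ (Submodule.subset_span ⟨k, rfl⟩)

/-- conversely every element of that span commutes with `N` (polynomials in `N` commute with `N`; every field, every `λ`). -/
theorem commute_of_mem_span_pow (lam : K) {φ : spikeSpan K n →ₗ[K] spikeSpan K n}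
    (hφ : φ ∈ Submodule.span K (Set.range fun k : Fin (n + 1) => (SbC K 1 lam 0 1 (n := n) - 1) ^ (k : ℕ))) :
    φ * (SbC K 1 lam 0 1 - 1) = (SbC K 1 lam 0 1 - 1) * φ := by
  induction hφ using Submodule.span_induction with
  | mem x hx => obtain ⟨k, rfl⟩ := hx; rw [← pow_succ, ← pow_succ']
  | zero => rw [zero_mul, mul_zero]
  | add x y _ _ hx hy => rw [add_mul, mul_add, hx, hy]
  | smul c x _ hx => rw [smul_mul_assoc, mul_smul_comm, hx]

/-- **the endomorphisms `N^0, N^1, …, N^n` are linearly independent when `n!·λ ≠ 0`** (their values on `E_0` are, K11). -/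
theorem linearIndependent_pow_shear_sub_one (hfac : ((n.factorial : ℕ) : K) ≠ 0) {lam : K} (hlam : lam ≠ 0) :
    LinearIndependent K fun k : Fin (n + 1) => (SbC K 1 lam 0 1 (n := n) - 1) ^ (k : ℕ) := by
  have hli := linearIndependent_pow_shear_spikeBasis_zero K hlam le_rfl (m := n + 1) (fun k hk => factorial_cast_ne_zero_of_lt_of_factorial K hfac hk)
  exact LinearIndependent.of_comp (LinearMap.applyₗ (spikeBasis K n 0)) hli

/-- **`dim span{N^0, …, N^n} = n + 1`** (`n!·λ ≠ 0`). -/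
theorem finrank_span_pow_shear_sub_one (hfac : ((n.factorial : ℕ) : K) ≠ 0) {lam : K} (hlam : lam ≠ 0) :
    finrank K ↥(Submodule.span K (Set.range fun k : Fin (n + 1) => (SbC K 1 lam 0 1 (n := n) - 1) ^ (k : ℕ))) = n + 1 := by
  rw [finrank_span_eq_card (linearIndependent_pow_shear_sub_one K hfac hlam), Fintype.card_fin]

/-- **THE CENTRALIZER OF THE SHEAR IS `K[SbC(shear λ)]`, OF DIMENSION `n + 1`, WHEN `n!·λ ≠ 0`: an endomorphism of th-7's class space commutes with `SbC(1 λ 0 1)` IFF it is a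
`K`-linear combination of `(SbC(1 λ 0 1) − 1)^k`, `k ≤ n`** (characteristic `0` or `p > n`; compare J13: adding the swap cuts the centralizer down to the scalars). -/
theorem commute_shear_iff_mem_span_pow (hfac : ((n.factorial : ℕ) : K) ≠ 0) {lam : K} (hlam : lam ≠ 0) (φ : spikeSpan K n →ₗ[K] spikeSpan K n) :
    φ * SbC K 1 lam 0 1 = SbC K 1 lam 0 1 * φ ↔ φ ∈ Submodule.span K (Set.range fun k : Fin (n + 1) => (SbC K 1 lam 0 1 (n := n) - 1) ^ (k : ℕ)) := by
  rw [commute_shear_iff_commute_sub_one]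
  exact ⟨mem_span_pow_of_commute_shear K hfac hlam, commute_of_mem_span_pow K lam⟩

/-- characteristic `0`: the centralizer of the shear is `K[N]` for every `λ ≠ 0`. -/
theorem commute_shear_iff_mem_span_pow_charZero [CharZero K] {lam : K} (hlam : lam ≠ 0) (φ : spikeSpan K n →ₗ[K] spikeSpan K n) :
    φ * SbC K 1 lam 0 1 = SbC K 1 lam 0 1 * φ ↔ φ ∈ Submodule.span K (Set.range fun k : Fin (n + 1) => (SbC K 1 lam 0 1 (n := n) - 1) ^ (k : ℕ)) :=
  commute_shear_iff_mem_span_pow K (Nat.cast_ne_zero.mpr (Nat.factorial_ne_zero n)) hlam φ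

end Summit.Ventures.HSemireg.Wedge.HankelFrameChange
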